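import Mathlib
import HarnessLib
import Literature.AlgebraicGeometry.Ramification.InertiaNormalSylow
import Summits.ResolutionOfSingularities.ResolutionOfSingularities.Theorems.WildQuotientsWildQuotientResolutionStubBorelCore
import Summits.ResolutionOfSingularities.ResolutionOfSingularities.Theorems.WildQuotientsWildQuotientResolutionUnipotentLevel
import Summits.ResolutionOfSingularities.ResolutionOfSingularities.Theorems.WildQuotientsWildQuotientResolutionFlagStep
import Summits.ResolutionOfSingularities.ResolutionOfSingularities.Theorems.WildQuotientsWildQuotientResolutionFlagStepPoint

/-!
# Point blow-up step with a hyperplane piece of rank `≤ 1`: inertia is p-closed (no NPC curves from point moves on threefolds — engine half)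

Crux stmt-ResolutionOfSingularities-15640 (`WildQuotientResolution`), registered stub
`stub_phaseZeroHighDim`, move-game track (`…PointMove`, `…FlagStepPoint`). The ENGINE half of the
statement «on a threefold, point moves create no curves of non-p-closed inertia, and every
non-p-closed point over a blown-up closed point `z` is `κ(z)`-rational» (this hand's memo
`PHASE0-DIM3-TERMINATION.md` §1, evidence on the item): with the point blow-up stalk package at `x`
over `z` (`PointBlowupStalkData.stub_pointBlowupStalkData`: `ι = π♯_x : R = 𝒪_{X′,z} → S = 𝒪_{X♯,x}`
injective local, `𝔪_R S = (ι t)`, the inertia `I = I_x` acting on `R` faithfully by `τ` and on `S`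
by `τ₁`, compatibly, residue-trivially), IF the hyperplane piece
`W̃ = {r ∈ 𝔪_R | ι r ∈ 𝔫_S · ι t}` has rank `≤ 1` modulo `𝔪_R²` (it is spanned mod `𝔪_R²` by one
of its elements `r₀`), THEN `I` is p-closed: `I` acts on the line `κ · r̄₀` through a character
`I → κˣ`, whose image is a finite p-closed (commutative) group and whose kernel moves `W̃` inside
`𝔪_R²`, so `FlagStepPoint.hasNormalSylow_of_pointBlowupStep` applies. The CHART half — for
`dim R = 3`, `rank W̄_x ≤ 1` unless `κ(x) = κ(z)` (`W̄_x` is the kernel of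
`𝔪/𝔪² → κ(x), r ↦ (ι r/ι t) mod 𝔫`, whose image generates the residue ring of the Rees chart) — is
left to a hand with `Literature/…/BlowupStalkCharts` (memo §1, size M).

* `mem_W_of_tau` — `W̃` is stable under the action (bookkeeping).
* `hasNormalSylow_of_pointBlowupStep_of_rank_le_one` — the theorem.

[OURS · crux stmt-ResolutionOfSingularities-15640 · helper toward `stub_phaseZeroHighDim`
(threefold Phase 0: no NPC curves from point moves; termination §2(b)); folklore local algebra,
counted 0; AI-level work, weaker than expert review.]
-/

-- single-problem summit: the doubled namespace component `ResolutionOfSingularities` is forced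
set_option linter.dupNamespace false

open IsLocalRing Literature.AlgebraicGeometry.Ramification
open Summit.ResolutionOfSingularities.ResolutionOfSingularities.Theorems.WildQuotientResolution.BorelCore
open Summit.ResolutionOfSingularities.ResolutionOfSingularities.Theorems.WildQuotientResolution.UnipotentLevel
open Summit.ResolutionOfSingularities.ResolutionOfSingularities.Theorems.WildQuotientResolution.FlagStep
open Summit.ResolutionOfSingularities.ResolutionOfSingularities.Theorems.WildQuotientResolution.FlagStepPoint

namespace Summit.ResolutionOfSingularities.ResolutionOfSingularities.Theorems.WildQuotientResolution.PointBlowupRankOne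

/-- **The hyperplane piece `W̃ = {r ∈ 𝔪_R | ι r ∈ 𝔫_S · ι t}` is stable under the action.** With
`ι ∘ τ g = τ₁ g ∘ ι`, `ι(𝔪_R) S = (ι t)`: if `ι r = s · ι t` with `s ∈ 𝔫_S` then
`ι (τ g r) = τ₁ g (s) · τ₁ g (ι t)` and `τ₁ g (ι t) = ι (τ g t) ∈ (ι t)`, so `ι (τ g r) ∈ 𝔫_S · ι t`.
[folklore] -/
theorem mem_W_of_tau {R S : Type*} [CommRing R] [IsLocalRing R] [CommRing S] [IsLocalRing S]
    (ι : R →+* S) (t : R) (ht : t ∈ maximalIdeal R)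
    (hgen : Ideal.map ι (maximalIdeal R) = Ideal.span {ι t})
    {I : Type*} [Group I] (τ : I →* (R ≃+* R)) (τ₁ : I →* (S ≃+* S))
    (hcomp : ∀ (g : I) (r : R), ι (τ g r) = τ₁ g (ι r))
    (g : I) {r : R} (hr : r ∈ maximalIdeal R) (hrW : ∃ s ∈ maximalIdeal S, ι r = s * ι t) :
    τ g r ∈ maximalIdeal R ∧ ∃ s ∈ maximalIdeal S, ι (τ g r) = s * ι t := by
  obtain ⟨s, hs, hrs⟩ := hrW
  refine ⟨ringAut_apply_mem_maximalIdeal (τ g) hr, ?_⟩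
  -- `τ₁ g (ι t) = ι (τ g t) = w * ι t`
  have htt : ι (τ g t) ∈ Ideal.span {ι t} :=
    hgen ▸ Ideal.mem_map_of_mem ι (ringAut_apply_mem_maximalIdeal (τ g) ht)
  obtain ⟨w, hw⟩ := Ideal.mem_span_singleton'.mp htt
  refine ⟨τ₁ g s * w, Ideal.mul_mem_right _ _ (ringAut_apply_mem_maximalIdeal (τ₁ g) hs), ?_⟩
  rw [hcomp, hrs, map_mul, ← hcomp, ← hw]
  ring

set_option maxHeartbeats 400000 in
/-- **Point blow-up step with a hyperplane piece of rank `≤ 1`.** Let `(R, 𝔪, κ)` be a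
Noetherian local ring and `(S, 𝔫)` a local domain, residue characteristics `p`; `ι : R → S` an
injective local homomorphism with `𝔪 S = (ι t)`, `t ∈ 𝔪`; `I` a finite group acting on `R`
faithfully by `τ` and on `S` by `τ₁`, compatibly and residue-trivially on `S`. Suppose the
hyperplane piece `W̃ = {r ∈ 𝔪 | ι r ∈ 𝔫 · ι t}` is spanned modulo `𝔪²` by ONE of its elements `r₀`
(`∀ r ∈ W̃, ∃ a, r − a r₀ ∈ 𝔪²`). Then `I` has a normal Sylow `p`-subgroup. Proof: if `r₀ ∈ 𝔪²` then
`W̃ ⊆ 𝔪²` and `FlagStepPoint.hasNormalSylow_of_pointBlowupStep` applies with the trivial group;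
otherwise `τ g r₀ ≡ c_g r₀ (mod 𝔪²)` with `c_g ∈ Rˣ` unique mod `𝔪` (`W̃` is `τ`-stable,
`mem_W_of_tau`), `g ↦ c̄_g ∈ κˣ` is a character `χ`, its image is a finite commutative hence
p-closed group (`FlagStep.hasNormalSylow_range_of_comm`), and `χ g = 1` forces `τ g r − r ∈ 𝔪²` on
all of `W̃` (`τ` is residue-trivial on `R`), which is the hypothesis of
`hasNormalSylow_of_pointBlowupStep`. On a threefold this is the case of every point `x` over `z`
with `κ(x) ≠ κ(z)` (memo §1): such points are p-closed. [folklore] -/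
theorem hasNormalSylow_of_pointBlowupStep_of_rank_le_one (p : ℕ) [Fact p.Prime]
    {R S : Type*} [CommRing R] [IsLocalRing R] [IsNoetherianRing R]
    [CommRing S] [IsLocalRing S] [IsDomain S]
    [CharP (ResidueField R) p] [CharP (ResidueField S) p]
    (ι : R →+* S) [IsLocalHom ι] (hι : Function.Injective ι)
    (t : R) (ht : t ∈ maximalIdeal R)
    (hgen : Ideal.map ι (maximalIdeal R) = Ideal.span {ι t})
    {I : Type*} [Group I] [Finite I] (τ : I →* (R ≃+* R)) (τ₁ : I →* (S ≃+* S))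
    (hτ : Function.Injective τ) (hcomp : ∀ (g : I) (r : R), ι (τ g r) = τ₁ g (ι r))
    (hres : ∀ (g : I) (s : S), τ₁ g s - s ∈ maximalIdeal S)
    (r₀ : R) (hr₀ : r₀ ∈ maximalIdeal R) (hr₀W : ∃ s ∈ maximalIdeal S, ι r₀ = s * ι t)
    (hW : ∀ r ∈ maximalIdeal R, (∃ s ∈ maximalIdeal S, ι r = s * ι t) →
      ∃ a : R, r - a * r₀ ∈ maximalIdeal R ^ 2) :
    HasNormalSylow p I := by
  classical
  -- `τ` is residue-trivial on `R` (`ι (τ g r - r) ∈ 𝔫`, `ι` local)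
  have hresR : ∀ (g : I) (r : R), τ g r - r ∈ maximalIdeal R := fun g r => by
    have h : ι (τ g r - r) ∈ maximalIdeal S := by rw [map_sub, hcomp]; exact hres g (ι r)
    rw [mem_maximalIdeal, mem_nonunits_iff] at h ⊢
    exact fun hu => h (hu.map ι)
  have hm2 : ∀ (g : I), ∀ x ∈ maximalIdeal R ^ 2, τ g x - x ∈ maximalIdeal R ^ 2 :=
    fun g x hx => ringEquiv_apply_sub_mem_maximalIdeal_pow (τ g) 2 hx
  -- ### case `r₀ ∈ 𝔪²`: `W̃ ⊆ 𝔪²`, trivial character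
  by_cases h0 : r₀ ∈ maximalIdeal R ^ 2
  · refine hasNormalSylow_of_pointBlowupStep p ι hι t ht hgen τ τ₁ hτ hcomp hres
      hasNormalSylow_punit (1 : I →* PUnit.{1}) fun g _ r hr hrW => ?_
    obtain ⟨a, ha⟩ := hW r hr hrW
    have hr2 : r ∈ maximalIdeal R ^ 2 := by
      have : r = (r - a * r₀) + a * r₀ := by ring
      rw [this]
      exact add_mem ha (Ideal.mul_mem_left _ a h0)
    exact hm2 g r hr2
  -- ### case `r₀ ∉ 𝔪²`: the character `g ↦ c_g`, `τ g r₀ ≡ c_g r₀ (mod 𝔪²)`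
  have hWτ : ∀ g : I, τ g r₀ ∈ maximalIdeal R ∧ ∃ s ∈ maximalIdeal S, ι (τ g r₀) = s * ι t :=
    fun g => mem_W_of_tau ι t ht hgen τ τ₁ hcomp g hr₀ hr₀W
  have hc : ∀ g : I, ∃ c : R, τ g r₀ - c * r₀ ∈ maximalIdeal R ^ 2 := fun g =>
    hW (τ g r₀) (hWτ g).1 (hWτ g).2
  choose c hc using hc
  -- uniqueness of `c_g` modulo `𝔪`: `(c - c') r₀ ∈ 𝔪²`, `r₀ ∉ 𝔪²` forces `c - c' ∈ 𝔪`
  have huniq : ∀ c₁ c₂ : R, (c₁ - c₂) * r₀ ∈ maximalIdeal R ^ 2 → c₁ - c₂ ∈ maximalIdeal R := by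
    intro c₁ c₂ h
    by_contra hu
    have hunit : IsUnit (c₁ - c₂) := by
      by_contra hnu
      exact hu ((mem_maximalIdeal _).mpr hnu)
    obtain ⟨u, hu'⟩ := hunit
    apply h0
    have : r₀ = ↑u⁻¹ * ((c₁ - c₂) * r₀) := by rw [← hu', ← mul_assoc, Units.inv_mul, one_mul]
    rw [this]
    exact Ideal.mul_mem_left _ _ h
  -- `c_g ∉ 𝔪` (else `τ g r₀ ∈ 𝔪²`, hence `r₀ ∈ 𝔪²`)
  have hτr₀ : ∀ g : I, τ g r₀ ∉ maximalIdeal R ^ 2 := fun g h => h0 (by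
    have h' := ringAut_apply_mem_maximalIdeal_pow (τ g⁻¹) 2 h
    rwa [← RingAut.mul_apply, ← map_mul, inv_mul_cancel, map_one, RingAut.one_apply] at h')
  have hcunit : ∀ g : I, c g ∉ maximalIdeal R := fun g hcg => hτr₀ g (by
    have : τ g r₀ = (τ g r₀ - c g * r₀) + c g * r₀ := by ring
    rw [this]
    refine add_mem (hc g) ?_
    rw [pow_two]
    exact Ideal.mul_mem_mul hcg hr₀)
  have hcres : ∀ g : I, residue R (c g) ≠ 0 := fun g h =>
    hcunit g ((residue_eq_zero_iff _).mp h)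
  -- multiplicativity modulo `𝔪`
  have hmul : ∀ g h : I, c (g * h) - c g * c h ∈ maximalIdeal R := by
    intro g h
    apply huniq
    -- `τ (g h) r₀ = τ g (τ h r₀) ≡ τ g (c h r₀) ≡ c h · τ g r₀ ≡ c h c g r₀`
    have e1 : τ (g * h) r₀ - c (g * h) * r₀ ∈ maximalIdeal R ^ 2 := hc (g * h)
    have e2 : τ g (τ h r₀ - c h * r₀) ∈ maximalIdeal R ^ 2 :=
      ringAut_apply_mem_maximalIdeal_pow (τ g) 2 (hc h)
    have e3 : (τ g (c h) - c h) * τ g r₀ ∈ maximalIdeal R ^ 2 := by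
      rw [pow_two]; exact Ideal.mul_mem_mul (hresR g (c h)) (hWτ g).1
    have e4 : c h * (τ g r₀ - c g * r₀) ∈ maximalIdeal R ^ 2 := Ideal.mul_mem_left _ _ (hc g)
    have key : (c (g * h) - c g * c h) * r₀ =
        -(τ (g * h) r₀ - c (g * h) * r₀) + τ g (τ h r₀ - c h * r₀) + (τ g (c h) - c h) * τ g r₀ +
          c h * (τ g r₀ - c g * r₀) := by
      rw [map_mul, RingAut.mul_apply, map_sub, map_mul]
      ring
    rw [key]
    exact add_mem (add_mem (add_mem (neg_mem e1) e2) e3) e4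
  -- the character `χ : I →* κˣ`
  let χ₀ : I → (ResidueField R)ˣ := fun g => Units.mk0 (residue R (c g)) (hcres g)
  have hχmul : ∀ g h : I, χ₀ (g * h) = χ₀ g * χ₀ h := by
    intro g h
    ext
    change residue R (c (g * h)) = residue R (c g) * residue R (c h)
    rw [← map_mul, ← sub_eq_zero, ← map_sub, residue_eq_zero_iff]
    exact hmul g h
  let χ : I →* (ResidueField R)ˣ := MonoidHom.mk' χ₀ hχmul
  haveI : Finite χ.range := Finite.of_surjective χ.rangeRestrict χ.rangeRestrict_surjective
  -- apply the point blow-up step with `A = χ.range`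
  refine hasNormalSylow_of_pointBlowupStep p ι hι t ht hgen τ τ₁ hτ hcomp hres
    (hasNormalSylow_range_of_comm (p := p) χ) χ.rangeRestrict fun g hg r hr hrW => ?_
  -- `χ g = 1`: `c_g ≡ 1 (mod 𝔪)`, so `τ g r₀ - r₀ ∈ 𝔪²`
  have hχ1 : residue R (c g) = 1 := by
    have h1 : χ g = 1 := by
      have := congrArg Subtype.val hg
      simpa using this
    have h2 : (χ g : ResidueField R) = residue R (c g) := rfl
    rw [← h2, h1, Units.val_one]
  have hc1 : c g - 1 ∈ maximalIdeal R := by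
    rw [← residue_eq_zero_iff, map_sub, map_one, hχ1, sub_self]
  have hr₀g : τ g r₀ - r₀ ∈ maximalIdeal R ^ 2 := by
    have : τ g r₀ - r₀ = (τ g r₀ - c g * r₀) + (c g - 1) * r₀ := by ring
    rw [this, pow_two]
    exact add_mem (pow_two (maximalIdeal R) ▸ hc g) (Ideal.mul_mem_mul hc1 hr₀)
  -- general `r ∈ W̃`: `r ≡ a r₀`
  obtain ⟨a, ha⟩ := hW r hr hrW
  have key : τ g r - r =
      (τ g (r - a * r₀) - (r - a * r₀)) + (τ g a - a) * τ g r₀ + a * (τ g r₀ - r₀) := by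
    rw [map_sub, map_mul]
    ring
  rw [key]
  refine add_mem (add_mem (hm2 g _ ha) ?_) (Ideal.mul_mem_left _ a hr₀g)
  rw [pow_two]
  exact Ideal.mul_mem_mul (hresR g a) (hWτ g).1

end Summit.ResolutionOfSingularities.ResolutionOfSingularities.Theorems.WildQuotientResolution.PointBlowupRankOne
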